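import Summits.CriticalPhenomena.SAWScalingLimit.Theorems.SAWDevelopingMapObservableToSLETypeLadderCarvedReductionSqueezeEnvelope
import Summits.CriticalPhenomena.SAWScalingLimit.Theorems.SAWDevelopingMapObservableToSLETypeLadderCarvedReductionSqueezeConeExit
import Mathlib.Analysis.InnerProductSpace.Basic
import HarnessLib

/-!
# The two EXITS of the framed super-domain: envelope + cone corridors + exit cross-cuts for both
# gates at once, pairwise apart (piece (T-A′ P1-exits) of stub T-A′
# `stub_carvedReduction_squeezeGeometry_domains`)

Crux `SAWDevelopingMap.ObservableToSLE` (stmt-CriticalPhenomena-10472), line `six-class-type-ladder`,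
stub T-A′ `stub_carvedReduction_squeezeGeometry_domains`.  Landing target:
`Summits/CriticalPhenomena/SAWScalingLimit/Theorems/SAWDevelopingMapObservableToSLETypeLadderCarvedReductionSqueezeExits.lean`
(`--supports stmt-CriticalPhenomena-10472`; registered carrier `stub_carvedReduction_exits`).
Assembles `stub_carvedReduction_envelope` (p143580) and `stub_carvedReduction_coneExit` (p143100).

For a Dobrushin domain `D`: its radial Schoenflies homeomorphism `H`, the unit directions `d i` of
the marks and an aperture `β ∈ (0, 1)` with the two cones `{(1 - β) ‖w‖ < re (w d̄ᵢ)}` disjoint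
(`‖d 0 + d 1‖ < 2` by the parallelogram law); then for every drift `τ`, reach `ϱ₀` and closeness
`ζ > 0`: radii `1 < r₁ < r₂`, the envelope `J = f (ball 0 r₂)` (`f = H - τ`,
`closure (D - τ) = f (closedBall 0 1)`, `closedBall (D.pt i - τ) ϱ₀ ⊆ J`), and for each gate an
exit cross-cut `η i` of `J` from `x i 0` to `x i 1` inside the EXIT ZONE `F i` (open, connected,
inside `J`, closure off `f (closedBall 0 1) = closure (D - τ)`, inside the image of the closed cone
`{1 ≤ re (w d̄ᵢ), (1 - β)‖w‖ < re (w d̄ᵢ)}`, containing a point `ζ`-close to the pinned root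
`D.pt i - τ`), the two gates' `F i ∪ {x i 0, x i 1}` disjoint, the endpoints on `∂J`.
-/

noncomputable section
open scoped Topology ComplexConjugate
open Filter Set Metric Function
open Literature.Probability.RandomPlanarGeometry
open Literature.Topology.PlaneTopology

namespace Summit.CriticalPhenomena.SAWScalingLimit.Theorems.ObservableToSLE.TypeLadder

/-- Distinct unit vectors of `ℂ` have `‖d₀ + d₁‖ < 2` (parallelogram law). -/
theorem norm_add_lt_two_of_ne {d₀ d₁ : ℂ} (h₀ : ‖d₀‖ = 1) (h₁ : ‖d₁‖ = 1) (hne : d₀ ≠ d₁) : ‖d₀ + d₁‖ < 2 := by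
  have hpar := parallelogram_law_with_norm ℝ d₀ d₁
  rw [h₀, h₁] at hpar
  have hsub : 0 < ‖d₀ - d₁‖ := norm_pos_iff.2 (sub_ne_zero.2 hne)
  have hle : ‖d₀ + d₁‖ ≤ 2 := by
    calc ‖d₀ + d₁‖ ≤ ‖d₀‖ + ‖d₁‖ := norm_add_le _ _
      _ = 2 := by rw [h₀, h₁]; norm_num
  rcases hle.lt_or_eq with hlt | heq
  · exact hlt
  · exfalso
    rw [heq] at hpar
    nlinarith

/-- **Registered carrier `stub_carvedReduction_exits`** (crux item stmt-CriticalPhenomena-10472,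
stub T-A′ `stub_carvedReduction_squeezeGeometry_domains`, piece THE TWO EXITS); see the module
docstring. -/
theorem stub_carvedReduction_exits :
    ∀ (D : DobrushinDomain), ∃ (H : ℂ ≃ₜ ℂ) (d : Fin 2 → ℂ) (β : ℝ),
      0 < β ∧ β < 1 ∧ (∀ i, ‖d i‖ = 1) ∧ d 0 ≠ d 1 ∧ (∀ i, H (d i) = D.pt i) ∧
      H '' ball 0 1 = D.carrier ∧ H '' closedBall 0 1 = closure D.carrier ∧
      (∀ w : ℂ, (1 - β) * ‖w‖ < (w * conj (d 0)).re → (1 - β) * ‖w‖ < (w * conj (d 1)).re → False) ∧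
      ∀ (τ : ℂ) (ϱ₀ ζ : ℝ), 0 < ζ →
        ∃ (r₁ r₂ : ℝ) (J : JordanDomain) (η : Fin 2 → Set ℂ) (x : Fin 2 → Fin 2 → ℂ) (F : Fin 2 → Set ℂ),
          1 < r₁ ∧ r₁ < r₂ ∧
          J.carrier = (H.trans (Homeomorph.addRight (-τ))) '' ball 0 r₂ ∧
          frontier J.carrier = (H.trans (Homeomorph.addRight (-τ))) '' sphere 0 r₂ ∧
          closure ((fun z => z - τ) '' D.carrier) = (H.trans (Homeomorph.addRight (-τ))) '' closedBall 0 1 ∧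
          closure ((fun z => z - τ) '' D.carrier) ⊆ J.carrier ∧
          (∀ i, closedBall (D.pt i - τ) ϱ₀ ⊆ J.carrier) ∧
          (∀ i, J.IsCrosscut (η i) (x i 0) (x i 1)) ∧ (∀ i, η i \ {x i 0, x i 1} ⊆ F i) ∧
          (∀ i, IsOpen (F i)) ∧ (∀ i, IsConnected (F i)) ∧ (∀ i, F i ⊆ J.carrier) ∧
          (∀ i, Disjoint (closure (F i)) ((H.trans (Homeomorph.addRight (-τ))) '' closedBall 0 1)) ∧
          (∀ i, F i ⊆ (H.trans (Homeomorph.addRight (-τ))) ''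
            {w : ℂ | 1 ≤ (w * conj (d i)).re ∧ (1 - β) * ‖w‖ < (w * conj (d i)).re}) ∧
          Disjoint (F 0 ∪ {x 0 0, x 0 1}) (F 1 ∪ {x 1 0, x 1 1}) ∧
          (∀ i, ∃ z ∈ F i, dist z (D.pt i - τ) < ζ) ∧
          (∀ i k, x i k ∈ frontier J.carrier) := by
  intro D
  obtain ⟨H, d, hdn, hd01, hHd, hball, hcl, -, henv⟩ := stub_carvedReduction_envelope D
  -- the aperture
  have hlt2 : ‖d 0 + d 1‖ < 2 := norm_add_lt_two_of_ne (hdn 0) (hdn 1) hd01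
  set β : ℝ := (1 - ‖d 0 + d 1‖ / 2) / 2 with hβ
  have hβ0 : 0 < β := by rw [hβ]; linarith
  have hβ1 : β < 1 := by rw [hβ]; linarith [norm_nonneg (d 0 + d 1)]
  have hβle : β ≤ 1 - ‖d 0 + d 1‖ / 2 := by rw [hβ]; linarith
  refine ⟨H, d, β, hβ0, hβ1, hdn, hd01, hHd, hball, hcl, fun w h0 h1 => coneCorridor_disjoint hβle h0 h1,
    fun τ ϱ₀ ζ hζ => ?_⟩
  obtain ⟨r₂, J, hr₂, hJcar, hJfr, hfball, hfcl, hfd, hballJ, hclJ⟩ := henv τ ϱ₀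
  set f : ℂ ≃ₜ ℂ := H.trans (Homeomorph.addRight (-τ)) with hf
  -- the inner radius: rays `f (s dᵢ)` are `ζ`-close to the pinned roots for `s` close to `1`
  have hray : ∀ i, ∀ᶠ s : ℝ in 𝓝 1, dist (f ((s : ℂ) * d i)) (D.pt i - τ) < ζ := fun i => by
    have hc : Continuous fun s : ℝ => f ((s : ℂ) * d i) := f.continuous.comp (by fun_prop)
    have h1 : f (((1 : ℝ) : ℂ) * d i) = D.pt i - τ := by rw [Complex.ofReal_one, one_mul]; exact hfd i
    have := hc.tendsto 1
    rw [h1] at this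
    exact (tendsto_iff_dist_tendsto_zero.1 this).eventually (gt_mem_nhds hζ)
  have hev : ∀ᶠ s : ℝ in 𝓝[>] 1, (∀ i, dist (f ((s : ℂ) * d i)) (D.pt i - τ) < ζ) ∧ s < r₂ ∧ 1 < s := by
    have h1 : ∀ᶠ s : ℝ in 𝓝[>] 1, (∀ i, dist (f ((s : ℂ) * d i)) (D.pt i - τ) < ζ) ∧ s < r₂ :=
      ((eventually_all.2 hray).and (eventually_lt_nhds hr₂)).filter_mono nhdsWithin_le_nhds
    have h2 : ∀ᶠ s : ℝ in 𝓝[>] 1, 1 < s := eventually_nhdsWithin_of_forall fun s hs => hs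
    filter_upwards [h1, h2] with s hs1 hs2
    exact ⟨hs1.1, hs1.2, hs2⟩
  obtain ⟨s₀, hs₀ζ, hs₀r, hs₀1⟩ := hev.exists
  set r₁ : ℝ := (1 + s₀) / 2 with hr₁
  have hr₁1 : 1 < r₁ := by rw [hr₁]; linarith
  have hr₁s : r₁ < s₀ := by rw [hr₁]; linarith
  have hr₁2 : r₁ < r₂ := hr₁s.trans hs₀r
  -- the two cone exits
  have key : ∀ i, ∃ (η : Set ℂ) (x₀ x₁ : ℂ), J.IsCrosscut η x₀ x₁ ∧
      η \ {x₀, x₁} ⊆ f '' {w : ℂ | r₁ < (w * conj (d i)).re ∧ ‖w‖ < r₂ ∧ (1 - β) * ‖w‖ < (w * conj (d i)).re} ∧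
      x₀ ∈ f '' {w : ℂ | ‖w‖ = r₂ ∧ (1 - β) * ‖w‖ < (w * conj (d i)).re} ∧
      x₁ ∈ f '' {w : ℂ | ‖w‖ = r₂ ∧ (1 - β) * ‖w‖ < (w * conj (d i)).re} ∧
      IsOpen (f '' {w : ℂ | r₁ < (w * conj (d i)).re ∧ ‖w‖ < r₂ ∧ (1 - β) * ‖w‖ < (w * conj (d i)).re}) ∧
      IsConnected (f '' {w : ℂ | r₁ < (w * conj (d i)).re ∧ ‖w‖ < r₂ ∧ (1 - β) * ‖w‖ < (w * conj (d i)).re}) ∧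
      f '' {w : ℂ | r₁ < (w * conj (d i)).re ∧ ‖w‖ < r₂ ∧ (1 - β) * ‖w‖ < (w * conj (d i)).re} ⊆ J.carrier ∧
      Disjoint (f '' {w : ℂ | r₁ < (w * conj (d i)).re ∧ ‖w‖ < r₂ ∧ (1 - β) * ‖w‖ < (w * conj (d i)).re})
        (f '' closedBall 0 r₁) ∧
      (∀ s : ℝ, r₁ < s → s < r₂ →
        f ((s : ℂ) * d i) ∈ f '' {w : ℂ | r₁ < (w * conj (d i)).re ∧ ‖w‖ < r₂ ∧ (1 - β) * ‖w‖ < (w * conj (d i)).re}) :=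
    fun i => stub_carvedReduction_coneExit J f (d i) r₁ r₂ β (hdn i) (by linarith) hr₁2 hβ0 hβ1 hJcar hJfr
  choose η x₀ x₁ hcut hηF hx₀ hx₁ hFo hFc hFJ hFdisj hrayF using key
  set G : Fin 2 → Set ℂ := fun i =>
    {w : ℂ | r₁ < (w * conj (d i)).re ∧ ‖w‖ < r₂ ∧ (1 - β) * ‖w‖ < (w * conj (d i)).re} with hG
  set x : Fin 2 → Fin 2 → ℂ := fun i k => if k = 0 then x₀ i else x₁ i with hx
  have hx0 : ∀ i, x i 0 = x₀ i := fun i => by simp [hx]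
  have hx1 : ∀ i, x i 1 = x₁ i := fun i => by simp [hx]
  -- cone bookkeeping: everything of gate `i` lies in the image of the open cone about `d i`
  have hcone : ∀ i, f '' G i ∪ {x i 0, x i 1} ⊆ f '' {w : ℂ | (1 - β) * ‖w‖ < (w * conj (d i)).re} := by
    intro i
    refine union_subset (image_mono fun w hw => hw.2.2) ?_
    rintro z (rfl | rfl)
    · rw [hx0]; obtain ⟨w, hw, hw'⟩ := hx₀ i; exact ⟨w, hw.2, hw'⟩
    · rw [hx1]; obtain ⟨w, hw, hw'⟩ := hx₁ i; exact ⟨w, hw.2, hw'⟩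
  refine ⟨r₁, r₂, J, η, x, fun i => f '' G i, hr₁1, hr₁2, hJcar, hJfr, hfcl.symm, hclJ, hballJ, fun i => ?_, fun i => ?_,
    hFo, hFc, hFJ, fun i => ?_, fun i => ?_, ?_, fun i => ?_, fun i k => ?_⟩
  · rw [hx0, hx1]; exact hcut i
  · rw [hx0, hx1]; exact hηF i
  · -- closure of the exit zone is off `f (closedBall 0 1)`
    show Disjoint (closure (f '' G i)) (f '' closedBall 0 1)
    rw [← f.image_closure]
    refine (Set.disjoint_image_iff f.injective).2 (Set.disjoint_left.2 fun w hw hw1 => ?_)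
    have hcl' : closure (G i) ⊆ {w : ℂ | r₁ ≤ (w * conj (d i)).re} :=
      closure_minimal (fun w hw => le_of_lt hw.1)
        (isClosed_le continuous_const (Complex.continuous_re.comp (continuous_id.mul continuous_const)))
    have h1 : r₁ ≤ (w * conj (d i)).re := hcl' hw
    have h2 := re_mul_conj_le_norm (hdn i) w
    rw [mem_closedBall, dist_zero_right] at hw1
    linarith
  · exact image_mono fun w hw => ⟨le_of_lt (hr₁1.trans hw.1), hw.2.2⟩
  · -- the two gates' exits are disjoint (disjoint cones, `f` injective)
    refine Set.disjoint_left.2 fun z hz0 hz1 => ?_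
    obtain ⟨w, hw, rfl⟩ := hcone 0 hz0
    obtain ⟨w', hw', hww'⟩ := hcone 1 hz1
    have : w' = w := f.injective hww'
    subst this
    exact coneCorridor_disjoint hβle hw hw'
  · exact ⟨f ((s₀ : ℂ) * d i), hrayF i s₀ hr₁s hs₀r, hs₀ζ i⟩
  · obtain ⟨-, h0, h1, -, -⟩ := hcut i
    fin_cases k
    · rw [show x i ⟨0, _⟩ = x₀ i from hx0 i]; exact h0
    · rw [show x i ⟨1, _⟩ = x₁ i from hx1 i]; exact h1

end Summit.CriticalPhenomena.SAWScalingLimit.Theorems.ObservableToSLE.TypeLadder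

end
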